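import Mathlib.MeasureTheory.Constructions.Polish.Basic
import Mathlib.MeasureTheory.Measure.Count
import Mathlib.MeasureTheory.Integral.Lebesgue.Countable
import Mathlib.MeasureTheory.Integral.Lebesgue.Map
import Mathlib.Order.Disjointed
import HarnessLib

/-!
# The fibre-count pull-back of a measure along a locally injective continuous map
(the measure-theoretic half of the Weyl integration formula without Jacobians; Lusin–Souslin)

Topic `MeasureTheory/Group`; namespace `Literature.MeasureTheory.Group`.  Theorems only (no definition,
no named fact, no instance, no `sorry`); Mathlib only.

SETTING.  `M` a Polish space and `X` a Hausdorff space, both with their Borel σ-algebras; `Φ : M → X`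
continuous; `D ⊆ M` a Borel set on which `Φ` is LOCALLY INJECTIVE (every `z ∈ D` has an open
neighbourhood `U` with `Φ` injective on `U ∩ D`); `ν` any measure on `X`.

THE RESULTS (all PROVED).
* `measurableSet_image_inter_of_locallyInjOn` — `Φ(E ∩ D)` is Borel for every Borel `E` (Lindelöf: `D` is
  covered by countably many injectivity patches, disjointified; Lusin–Souslin on each patch, Mathlib
  `MeasurableSet.image_of_continuousOn_injOn`).
* `measurable_count_preimage_singleton_inter` — the FIBRE COUNT `y ↦ #(Φ⁻¹{y} ∩ E ∩ D)` (Mathlib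
  `Measure.count`, values in `[0, ∞]`) is Borel: it is the sum of the indicators of the images of the patches.
* `exists_measure_apply_eq_lintegral_count_fibre` — **the fibre-count pull-back**: there is a measure `μ`
  on `M` with `μ(E) = ∫ #(Φ⁻¹{y} ∩ E ∩ D) dν(y)` for every Borel `E` (the sum over the patches `S_n` of the
  pull-backs `ν(Φ(E ∩ S_n))`).  When `Φ` is a finite-sheeted local homeomorphism this is the measure
  «`Φ^* ν`» against which `∫_M F dμ = ∫_X Σ_{Φ z = y} F(z) dν(y)`.
* Riders, for ANY measure `μ` satisfying the displayed formula: `μ(M ∖ D) = 0` (`…_apply_compl_eq_zero`);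
  the bound `μ(E) ≤ w · ν(Φ(E ∩ D))` when all fibres in `D` have at most `w` points (`…_apply_le_mul`);
  **`Φ_* μ = w · ν|_{Φ(D)}`** when all fibres over `Φ(D)` have exactly `w` points in `D`
  (`map_eq_smul_restrict_image_of_count_fibre_eq`) with its `∫⁻` form; and **EQUIVARIANCE**
  (`apply_preimage_eq_of_semiconj`): for bijections `α` of `M` preserving `D` and `β` of `X` preserving `ν`
  with `Φ ∘ α = β ∘ Φ`, `μ(α⁻¹ E) = μ(E)` (`α` maps the fibre over `y` inside `α⁻¹E ∩ D` bijectively onto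
  the fibre over `β y` inside `E ∩ D`).

WHY (the use).  For a locally compact group `G`, a closed abelian subgroup `T` and the conjugation map
`Φ(xT, t) = x t x⁻¹` on `M = G ⧸ T × T`, restricted to the `T`-regular set `D`, `Φ` is a `|N(T)/T|`-sheeted
local homeomorphism; the pull-back `μ` of a Haar measure is `G`-invariant by equivariance, hence a product
`(dx/dt) ⊗ σ` by the uniqueness of invariant measures on `G ⧸ T` (Weil's relative factorisation,
`InvariantOrbitMeasureUniqueness`), which yields the Weyl integration formula on the `T`-regular set with an
unspecified radial measure `σ` — enough for its VANISHING form («a test function all of whose regular orbital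
integrals vanish has integral zero»), see `ConjugationWeylVanishing`.  The construction is [Federer1969, §2.10.10
Theorem] (the measure `ψ(A) = ∫ N(f|A, y) dμ(y)` built from `ζ(S) = μ[f(S)]`, `N(f|A, ·)` the multiplicity function),
specialised to locally injective continuous `f`, for which «`f(A)` is `μ` measurable whenever `A` is Borel» is the
Lusin–Souslin theorem [Kechris1995, Thm. 15.1]; cf. the proof of [HarishChandra1970, Lemma 42].

## References
* [Federer1969] H. Federer, *Geometric Measure Theory*, Grundlehren 153 (1969), §2.10.10 Theorem (the measure
  `ψ(A) = ∫ N(f|A, y) dμ y`).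
* [Kechris1995] A. S. Kechris, *Classical Descriptive Set Theory*, GTM 156 (1995), Thm. 15.1.
* [DeitmarEchterhoff2014] A. Deitmar, S. Echterhoff, *Principles of Harmonic Analysis*, 2nd ed. (2014), §1.5.
* [HarishChandra1970] Harish-Chandra, *Harmonic analysis on reductive p-adic groups*, LNM 162 (1970), Lemma 42.
-/

set_option autoImplicit false

noncomputable section

open MeasureTheory Measure Set Filter Topology Function
open scoped ENNReal NNReal

namespace Literature.MeasureTheory.Group

section FibreCount

variable {M X : Type*} [TopologicalSpace M] [PolishSpace M] [MeasurableSpace M] [BorelSpace M]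
  [TopologicalSpace X] [T2Space X] [MeasurableSpace X] [BorelSpace X]
  {Φ : M → X} {D : Set M}

/-- **Countable disjoint injectivity patches.**  If `Φ` is locally injective on the Borel set `D` of the
Polish space `M`, there are pairwise disjoint Borel sets `S n ⊆ D` covering `D` on each of which `Φ` is
injective (Lindelöf for the injectivity neighbourhoods, then disjointification) — the Borel partitions of
[Federer1969, §2.10.10 (proof)]. [cite: Federer1969, §2.10.10] -/
theorem exists_disjoint_injOn_cover {X : Type*} {Φ : M → X} (hD : MeasurableSet D)
    (hinj : ∀ z ∈ D, ∃ U : Set M, IsOpen U ∧ z ∈ U ∧ InjOn Φ (U ∩ D)) :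
    ∃ S : ℕ → Set M, (∀ n, MeasurableSet (S n)) ∧ (∀ n, S n ⊆ D) ∧ (∀ n, InjOn Φ (S n)) ∧
      Pairwise (Disjoint on S) ∧ (⋃ n, S n) = D := by
  classical
  -- an `ℕ`-indexed family of open injectivity patches covering `D`
  obtain ⟨U, hUo, hUi, hUD⟩ : ∃ U : ℕ → Set M, (∀ n, IsOpen (U n)) ∧ (∀ n, InjOn Φ (U n ∩ D)) ∧
      D ⊆ ⋃ n, U n := by
    choose! U hUo hUz hUi using hinj
    obtain ⟨T, hTc, hTU⟩ := TopologicalSpace.isOpen_iUnion_countable (fun z : D => U z) fun z => hUo z z.2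
    rcases T.eq_empty_or_nonempty with hT | hT
    · -- no patch is needed: `D` is empty
      have hDe : D = ∅ := by
        rcases D.eq_empty_or_nonempty with h | ⟨z, hz⟩
        · exact h
        · have hz' : z ∈ ⋃ i : D, U i := mem_iUnion.2 ⟨⟨z, hz⟩, hUz z hz⟩
          rw [← hTU, hT] at hz'
          simp at hz'
      exact ⟨fun _ => ∅, fun _ => isOpen_empty, fun _ => by simp [InjOn], by simp [hDe]⟩
    · obtain ⟨f, hf⟩ := hTc.exists_eq_range hT
      refine ⟨fun n => U (f n), fun n => hUo _ (f n).2, fun n => hUi _ (f n).2, fun z hz => ?_⟩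
      have hz' : z ∈ ⋃ i : D, U i := mem_iUnion.2 ⟨⟨z, hz⟩, hUz z hz⟩
      rw [← hTU] at hz'
      simp only [mem_iUnion, exists_prop] at hz'
      obtain ⟨i, hi, hzi⟩ := hz'
      rw [hf] at hi
      obtain ⟨n, rfl⟩ := hi
      exact mem_iUnion.2 ⟨n, hzi⟩
  refine ⟨disjointed fun n => U n ∩ D, fun n => ?_, fun n => ?_, fun n => ?_, disjoint_disjointed _, ?_⟩
  · exact MeasurableSet.disjointed (fun n => (hUo n).measurableSet.inter hD) n
  · exact (disjointed_subset (fun n => U n ∩ D) n).trans inter_subset_right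
  · exact (hUi n).mono (disjointed_subset (fun n => U n ∩ D) n)
  · rw [iUnion_disjointed, ← iUnion_inter]
    exact inter_eq_right.2 hUD

/-- **Lusin–Souslin on the patches**: `Φ(E ∩ D)` is Borel for every Borel `E ⊆ M` when `Φ` is continuous
and locally injective on the Borel set `D`. [cite: Kechris1995, Thm. 15.1] -/
theorem measurableSet_image_inter_of_locallyInjOn (hD : MeasurableSet D) (hΦ : Continuous Φ)
    (hinj : ∀ z ∈ D, ∃ U : Set M, IsOpen U ∧ z ∈ U ∧ InjOn Φ (U ∩ D)) {E : Set M}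
    (hE : MeasurableSet E) : MeasurableSet (Φ '' (E ∩ D)) := by
  obtain ⟨S, hSm, -, hSi, -, hSU⟩ := exists_disjoint_injOn_cover hD hinj
  have : Φ '' (E ∩ D) = ⋃ n, Φ '' (E ∩ S n) := by
    rw [← hSU, inter_iUnion, image_iUnion]
  rw [this]
  exact MeasurableSet.iUnion fun n =>
    (hE.inter (hSm n)).image_of_continuousOn_injOn hΦ.continuousOn ((hSi n).mono inter_subset_right)

/-- `Φ(D)` is Borel. [cite: Kechris1995, Thm. 15.1] -/
theorem measurableSet_image_of_locallyInjOn (hD : MeasurableSet D) (hΦ : Continuous Φ)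
    (hinj : ∀ z ∈ D, ∃ U : Set M, IsOpen U ∧ z ∈ U ∧ InjOn Φ (U ∩ D)) : MeasurableSet (Φ '' D) := by
  simpa only [univ_inter] using measurableSet_image_inter_of_locallyInjOn hD hΦ hinj MeasurableSet.univ

omit [TopologicalSpace M] [PolishSpace M] [BorelSpace M] in
/-- On an injectivity patch `S`, the fibre `Φ⁻¹{y} ∩ (E ∩ S)` has count `1_{Φ(E ∩ S)}(y)` (the characteristic
functions `c_S` of [Federer1969, §2.10.10 (proof)]). [cite: Federer1969, §2.10.10] -/
theorem count_preimage_singleton_inter_eq_indicator {X : Type*} {Φ : M → X} [MeasurableSingletonClass M]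
    {S E : Set M} (hS : InjOn Φ S) (y : X) :
    Measure.count (Φ ⁻¹' {y} ∩ (E ∩ S)) = (Φ '' (E ∩ S)).indicator 1 y := by
  classical
  by_cases hy : y ∈ Φ '' (E ∩ S)
  · obtain ⟨z, hz, rfl⟩ := hy
    have hset : Φ ⁻¹' {Φ z} ∩ (E ∩ S) = {z} := by
      ext u
      simp only [mem_inter_iff, mem_preimage, mem_singleton_iff]
      constructor
      · rintro ⟨hu, -, huS⟩
        exact hS huS hz.2 hu
      · rintro rfl
        exact ⟨rfl, hz⟩
    rw [hset, Measure.count_singleton, indicator_of_mem (mem_image_of_mem Φ hz), Pi.one_apply]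
  · have hset : Φ ⁻¹' {y} ∩ (E ∩ S) = ∅ := by
      ext u
      simp only [mem_inter_iff, mem_preimage, mem_singleton_iff, mem_empty_iff_false, iff_false, not_and]
      intro hu hE huS
      exact hy ⟨u, ⟨hE, huS⟩, hu⟩
    rw [hset, measure_empty, indicator_of_notMem hy]

/-- **The fibre count is the sum of the patch indicators**: for disjoint injectivity patches `S n` covering
`D`, `#(Φ⁻¹{y} ∩ E ∩ D) = Σ_n 1_{Φ(E ∩ S_n)}(y)` — Federer's `Σ_{S ∈ H_j} c_S(y) ↑ N(f|A, y)`, here with a single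
partition since `Φ` is injective on each patch. [cite: Federer1969, §2.10.10] -/
theorem count_preimage_singleton_inter_eq_tsum_indicator (hΦ : Continuous Φ) {S : ℕ → Set M}
    (hSm : ∀ n, MeasurableSet (S n)) (hSi : ∀ n, InjOn Φ (S n)) (hSd : Pairwise (Disjoint on S))
    (hSU : (⋃ n, S n) = D) {E : Set M} (hE : MeasurableSet E) (y : X) :
    Measure.count (Φ ⁻¹' {y} ∩ (E ∩ D)) = ∑' n, (Φ '' (E ∩ S n)).indicator 1 y := by
  have hsplit : Φ ⁻¹' {y} ∩ (E ∩ D) = ⋃ n, Φ ⁻¹' {y} ∩ (E ∩ S n) := by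
    rw [← hSU, inter_iUnion, inter_iUnion]
  rw [hsplit, measure_iUnion]
  · exact tsum_congr fun n => count_preimage_singleton_inter_eq_indicator (hSi n) y
  · intro i j hij
    exact ((hSd hij).mono inter_subset_right inter_subset_right).mono inter_subset_right inter_subset_right
  · intro n
    exact (hΦ.measurable (measurableSet_singleton y)).inter (hE.inter (hSm n))

/-- **The multiplicity function `y ↦ N(Φ|E ∩ D, y) = #(Φ⁻¹{y} ∩ E ∩ D)` is Borel** for Borel `E` (Federer's
`N(f|A, ·)`; here via Lusin–Souslin on the patches). [cite: Federer1969, §2.10.10] [cite: Kechris1995, Thm. 15.1] -/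
theorem measurable_count_preimage_singleton_inter (hD : MeasurableSet D) (hΦ : Continuous Φ)
    (hinj : ∀ z ∈ D, ∃ U : Set M, IsOpen U ∧ z ∈ U ∧ InjOn Φ (U ∩ D)) {E : Set M}
    (hE : MeasurableSet E) : Measurable fun y => Measure.count (Φ ⁻¹' {y} ∩ (E ∩ D)) := by
  obtain ⟨S, hSm, -, hSi, hSd, hSU⟩ := exists_disjoint_injOn_cover hD hinj
  have : (fun y => Measure.count (Φ ⁻¹' {y} ∩ (E ∩ D))) = fun y => ∑' n, (Φ '' (E ∩ S n)).indicator 1 y :=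
    funext fun y => count_preimage_singleton_inter_eq_tsum_indicator hΦ hSm hSi hSd hSU hE y
  rw [this]
  refine Measurable.tsum fun n => (measurable_one.indicator ?_)
  exact (hE.inter (hSm n)).image_of_continuousOn_injOn hΦ.continuousOn ((hSi n).mono inter_subset_right)

/-- **The fibre-count pull-back measure.**  For `Φ : M → X` continuous and locally injective on the Borel set
`D ⊆ M` (`M` Polish, `X` Hausdorff) and any measure `ν` on `X`, there is a measure `μ` on `M` with
`μ(E) = ∫ #(Φ⁻¹{y} ∩ E ∩ D) dν(y)` for every Borel `E` — the pull-back «`Φ^*ν`» restricted to `D`, built as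
the sum over disjoint injectivity patches `S_n` of `E ↦ ν(Φ(E ∩ S_n))`.  This is [Federer1969, §2.10.10 Theorem]
(«`ψ(A) = ∫ N(f|A, y) dμ y` for every Borel set `A ⊂ X`») for locally injective continuous `f`, where the
hypothesis «`f(A)` is `μ` measurable for Borel `A`» holds by Lusin–Souslin. [cite: Federer1969, §2.10.10 Theorem]
[cite: Kechris1995, Thm. 15.1] -/
theorem exists_measure_apply_eq_lintegral_count_fibre (hD : MeasurableSet D) (hΦ : Continuous Φ)
    (hinj : ∀ z ∈ D, ∃ U : Set M, IsOpen U ∧ z ∈ U ∧ InjOn Φ (U ∩ D)) (ν : Measure X) :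
    ∃ μ : Measure M, ∀ E : Set M, MeasurableSet E →
      μ E = ∫⁻ y, Measure.count (Φ ⁻¹' {y} ∩ (E ∩ D)) ∂ν := by
  obtain ⟨S, hSm, -, hSi, hSd, hSU⟩ := exists_disjoint_injOn_cover hD hinj
  -- the patch maps are measurable embeddings (Lusin–Souslin)
  have hemb : ∀ n, MeasurableEmbedding ((S n).restrict Φ) := fun n =>
    hΦ.continuousOn.measurableEmbedding (hSm n) (hSi n)
  refine ⟨Measure.sum fun n => ((ν.comap ((S n).restrict Φ)).map (Subtype.val : S n → M)), fun E hE => ?_⟩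
  rw [Measure.sum_apply _ hE]
  have hpiece : ∀ n, ((ν.comap ((S n).restrict Φ)).map (Subtype.val : S n → M)) E = ν (Φ '' (E ∩ S n)) := by
    intro n
    rw [Measure.map_apply measurable_subtype_coe hE, (hemb n).comap_apply]
    congr 1
    ext x
    simp only [mem_image, mem_preimage, Set.restrict_apply, Subtype.exists, exists_and_left, mem_inter_iff]
    constructor
    · rintro ⟨z, hzE, hzS, rfl⟩
      exact ⟨z, ⟨hzE, hzS⟩, rfl⟩
    · rintro ⟨z, ⟨hzE, hzS⟩, rfl⟩
      exact ⟨z, hzE, hzS, rfl⟩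
  simp_rw [hpiece]
  have hmeas : ∀ n, MeasurableSet (Φ '' (E ∩ S n)) := fun n =>
    (hE.inter (hSm n)).image_of_continuousOn_injOn hΦ.continuousOn ((hSi n).mono inter_subset_right)
  calc ∑' n, ν (Φ '' (E ∩ S n)) = ∑' n, ∫⁻ y, (Φ '' (E ∩ S n)).indicator 1 y ∂ν := by
        refine tsum_congr fun n => ?_
        rw [lintegral_indicator_one (hmeas n)]
    _ = ∫⁻ y, ∑' n, (Φ '' (E ∩ S n)).indicator 1 y ∂ν := by
        rw [lintegral_tsum fun n => ((measurable_one.indicator (hmeas n)).aemeasurable)]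
    _ = ∫⁻ y, Measure.count (Φ ⁻¹' {y} ∩ (E ∩ D)) ∂ν := by
        refine lintegral_congr fun y => ?_
        rw [count_preimage_singleton_inter_eq_tsum_indicator hΦ hSm hSi hSd hSU hE y]

/-! ### Riders: consequences of the fibre-count formula -/

variable {ν : Measure X} {μ : Measure M}

omit [TopologicalSpace M] [PolishSpace M] [BorelSpace M] [TopologicalSpace X] [T2Space X] [BorelSpace X] in
/-- A fibre-count pull-back is carried by `D` (`N(f|A, ·) = 0` when `A ∩ D = ∅`). [cite: Federer1969, §2.10.10] -/
theorem apply_eq_zero_of_inter_eq_empty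
    (hμ : ∀ E : Set M, MeasurableSet E → μ E = ∫⁻ y, Measure.count (Φ ⁻¹' {y} ∩ (E ∩ D)) ∂ν)
    {E : Set M} (hE : MeasurableSet E) (hED : E ∩ D = ∅) : μ E = 0 := by
  rw [hμ E hE]
  simp [hED]

omit [TopologicalSpace M] [PolishSpace M] [BorelSpace M] [TopologicalSpace X] [T2Space X] [BorelSpace X] in
/-- In particular `μ(M ∖ D) = 0`. [cite: Federer1969, §2.10.10] -/
theorem apply_compl_eq_zero (hD : MeasurableSet D)
    (hμ : ∀ E : Set M, MeasurableSet E → μ E = ∫⁻ y, Measure.count (Φ ⁻¹' {y} ∩ (E ∩ D)) ∂ν) :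
    μ Dᶜ = 0 :=
  apply_eq_zero_of_inter_eq_empty hμ hD.compl (compl_inter_self D)

/-- **Mass bound**: if every fibre meets `D` in at most `w` points then `μ(E) ≤ w · ν(Φ(E ∩ D))`; in
particular `μ` is finite on every Borel set whose image has finite `ν`-measure (`N(f|A, y) ≤ w · 1_{f(A)}(y)`).
[cite: Federer1969, §2.10.10] -/
theorem apply_le_mul_measure_image (hD : MeasurableSet D) (hΦ : Continuous Φ)
    (hinj : ∀ z ∈ D, ∃ U : Set M, IsOpen U ∧ z ∈ U ∧ InjOn Φ (U ∩ D))
    (hμ : ∀ E : Set M, MeasurableSet E → μ E = ∫⁻ y, Measure.count (Φ ⁻¹' {y} ∩ (E ∩ D)) ∂ν)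
    {w : ℝ≥0∞} (hw : ∀ y, Measure.count (Φ ⁻¹' {y} ∩ D) ≤ w) {E : Set M} (hE : MeasurableSet E) :
    μ E ≤ w * ν (Φ '' (E ∩ D)) := by
  have hEi : MeasurableSet (Φ '' (E ∩ D)) := measurableSet_image_inter_of_locallyInjOn hD hΦ hinj hE
  rw [hμ E hE, ← lintegral_indicator_one hEi, ← lintegral_const_mul w (measurable_one.indicator hEi)]
  refine lintegral_mono fun y => ?_
  by_cases hy : y ∈ Φ '' (E ∩ D)
  · rw [indicator_of_mem hy, Pi.one_apply, mul_one]
    exact (measure_mono (inter_subset_inter_right _ inter_subset_right)).trans (hw y)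
  · have : Φ ⁻¹' {y} ∩ (E ∩ D) = ∅ := by
      ext u
      simp only [mem_inter_iff, mem_preimage, mem_singleton_iff, mem_empty_iff_false, iff_false, not_and]
      intro hu huE huD
      exact hy ⟨u, ⟨huE, huD⟩, hu⟩
    rw [this, measure_empty]
    exact zero_le

/-- **Push-forward under constant fibre count**: if every fibre over `Φ(D)` meets `D` in exactly `w` points,
then `Φ_* μ = w · ν|_{Φ(D)}` (`N(f|f⁻¹B ∩ D, y) = w · 1_{B ∩ f(D)}(y)`). [cite: Federer1969, §2.10.10] -/
theorem map_eq_smul_restrict_image_of_count_fibre_eq (hD : MeasurableSet D) (hΦ : Continuous Φ)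
    (hinj : ∀ z ∈ D, ∃ U : Set M, IsOpen U ∧ z ∈ U ∧ InjOn Φ (U ∩ D))
    (hμ : ∀ E : Set M, MeasurableSet E → μ E = ∫⁻ y, Measure.count (Φ ⁻¹' {y} ∩ (E ∩ D)) ∂ν)
    {w : ℝ≥0∞} (hw : ∀ y ∈ Φ '' D, Measure.count (Φ ⁻¹' {y} ∩ D) = w) :
    μ.map Φ = w • ν.restrict (Φ '' D) := by
  have hΦD := measurableSet_image_of_locallyInjOn hD hΦ hinj
  ext E hE
  rw [Measure.map_apply hΦ.measurable hE, hμ _ (hΦ.measurable hE), Measure.smul_apply,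
    Measure.restrict_apply hE, smul_eq_mul, ← lintegral_indicator_one (hE.inter hΦD),
    ← lintegral_const_mul w (measurable_one.indicator (hE.inter hΦD))]
  refine lintegral_congr fun y => ?_
  by_cases hyE : y ∈ E
  · have h1 : Φ ⁻¹' {y} ∩ (Φ ⁻¹' E ∩ D) = Φ ⁻¹' {y} ∩ D := by
      ext u
      simp only [mem_inter_iff, mem_preimage, mem_singleton_iff, and_congr_right_iff]
      intro hu
      rw [hu]
      exact ⟨fun h => h.2, fun h => ⟨hyE, h⟩⟩
    rw [h1]
    by_cases hyD : y ∈ Φ '' D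
    · rw [hw y hyD, indicator_of_mem (show y ∈ E ∩ Φ '' D from ⟨hyE, hyD⟩), Pi.one_apply, mul_one]
    · have : Φ ⁻¹' {y} ∩ D = ∅ := by
        ext u
        simp only [mem_inter_iff, mem_preimage, mem_singleton_iff, mem_empty_iff_false, iff_false, not_and]
        exact fun hu huD => hyD ⟨u, huD, hu⟩
      rw [this, measure_empty, indicator_of_notMem (fun h => hyD h.2), mul_zero]
  · have : Φ ⁻¹' {y} ∩ (Φ ⁻¹' E ∩ D) = ∅ := by
      ext u
      simp only [mem_inter_iff, mem_preimage, mem_singleton_iff, mem_empty_iff_false, iff_false, not_and]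
      intro hu huE _
      exact hyE (hu ▸ huE)
    rw [this, measure_empty, indicator_of_notMem (fun h => hyE h.1), mul_zero]

/-- The `∫⁻` form of `map_eq_smul_restrict_image_of_count_fibre_eq`: `∫_M f(Φ z) dμ(z) = w ∫_{Φ(D)} f dν` for
Borel `f ≥ 0`. [cite: Federer1969, §2.10.10] -/
theorem lintegral_comp_eq_mul_setLIntegral_image (hD : MeasurableSet D) (hΦ : Continuous Φ)
    (hinj : ∀ z ∈ D, ∃ U : Set M, IsOpen U ∧ z ∈ U ∧ InjOn Φ (U ∩ D))
    (hμ : ∀ E : Set M, MeasurableSet E → μ E = ∫⁻ y, Measure.count (Φ ⁻¹' {y} ∩ (E ∩ D)) ∂ν)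
    {w : ℝ≥0∞} (hw : ∀ y ∈ Φ '' D, Measure.count (Φ ⁻¹' {y} ∩ D) = w)
    {f : X → ℝ≥0∞} (hf : Measurable f) :
    ∫⁻ z, f (Φ z) ∂μ = w * ∫⁻ y in Φ '' D, f y ∂ν := by
  rw [← lintegral_map hf hΦ.measurable, map_eq_smul_restrict_image_of_count_fibre_eq hD hΦ hinj hμ hw,
    lintegral_smul_measure, smul_eq_mul]

/-- **Equivariance of the fibre-count pull-back.**  Let `α` be a bijection of `M` preserving `D` and `β` a
bijection of `X`, both Borel, with `Φ ∘ α = β ∘ Φ` and `β_* ν = ν`.  Then `μ(α⁻¹ E) = μ(E)` for every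
Borel `E`: `α` maps `Φ⁻¹{y} ∩ α⁻¹E ∩ D` bijectively onto `Φ⁻¹{β y} ∩ E ∩ D`, and `ν` is `β`-invariant.
(For the conjugation map of a group: `α = ` left translation on `G ⧸ T`, `β = ` conjugation on `G`.)  A consequence
of the multiplicity formula: `N(Φ|α⁻¹A ∩ D, y) = N(Φ|A ∩ D, β y)`. [cite: Federer1969, §2.10.10] -/
theorem apply_preimage_eq_of_semiconj (hD : MeasurableSet D) (hΦ : Continuous Φ)
    (hinj : ∀ z ∈ D, ∃ U : Set M, IsOpen U ∧ z ∈ U ∧ InjOn Φ (U ∩ D))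
    (hμ : ∀ E : Set M, MeasurableSet E → μ E = ∫⁻ y, Measure.count (Φ ⁻¹' {y} ∩ (E ∩ D)) ∂ν)
    (α : M ≃ M) (β : X ≃ X) (hα : Measurable α) (hβ : Measurable β)
    (hcomm : ∀ z, Φ (α z) = β (Φ z)) (hαD : ∀ z, α z ∈ D ↔ z ∈ D) (hν : ν.map β = ν)
    {E : Set M} (hE : MeasurableSet E) : μ (α ⁻¹' E) = μ E := by
  have hE' : MeasurableSet (α ⁻¹' E) := hα hE
  rw [hμ _ hE', hμ _ hE]
  -- the fibre over `y` inside `α⁻¹ E ∩ D` is carried by `α` onto the fibre over `β y` inside `E ∩ D`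
  have hfib : ∀ y, α '' (Φ ⁻¹' {y} ∩ (α ⁻¹' E ∩ D)) = Φ ⁻¹' {β y} ∩ (E ∩ D) := by
    intro y
    ext u
    simp only [mem_image, mem_inter_iff, mem_preimage, mem_singleton_iff]
    constructor
    · rintro ⟨z, ⟨hz, hzE, hzD⟩, rfl⟩
      exact ⟨by rw [hcomm, hz], hzE, (hαD z).2 hzD⟩
    · rintro ⟨hu, huE, huD⟩
      refine ⟨α.symm u, ⟨?_, ?_, ?_⟩, α.apply_symm_apply u⟩
      · have h := hcomm (α.symm u)
        rw [α.apply_symm_apply, hu] at h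
        exact β.injective h.symm
      · simpa only [mem_preimage, α.apply_symm_apply] using huE
      · exact (hαD _).1 (by simpa only [α.apply_symm_apply] using huD)
  have hcount : ∀ y, Measure.count (Φ ⁻¹' {y} ∩ (α ⁻¹' E ∩ D)) =
      Measure.count (Φ ⁻¹' {β y} ∩ (E ∩ D)) := by
    intro y
    rw [← hfib y, Measure.count_injective_image' α.injective]
    · exact (hΦ.measurable (measurableSet_singleton y)).inter (hE'.inter hD)
    · rw [hfib y]
      exact (hΦ.measurable (measurableSet_singleton _)).inter (hE.inter hD)
  simp_rw [hcount]
  have hF := measurable_count_preimage_singleton_inter hD hΦ hinj hE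
  calc ∫⁻ y, Measure.count (Φ ⁻¹' {β y} ∩ (E ∩ D)) ∂ν
      = ∫⁻ y, Measure.count (Φ ⁻¹' {y} ∩ (E ∩ D)) ∂(ν.map β) := (lintegral_map hF hβ).symm
    _ = ∫⁻ y, Measure.count (Φ ⁻¹' {y} ∩ (E ∩ D)) ∂ν := by rw [hν]

end FibreCount

end Literature.MeasureTheory.Group

end
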